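import Summits.BirchSwinnertonDyer.BirchSwinnertonDyer.Theorems.ByReductionTypeAtTwoOrdIsogenyTransport
import Summits.BirchSwinnertonDyer.Rank1Residual.X1.MuPart
import Literature.NumberTheory.EllipticCurves.ModularCurveManinSemistableBridgeProofs
import Literature.NumberTheory.EllipticCurves.IsogenyDualProofs
import HarnessLib

/-!
# Route `ByReductionTypeAtTwo` (K4), crux `OrdMissingLowerBoundAtTwo` (stmt-BirchSwinnertonDyer-19577), line
# `kato-free-lower-sandwich-two` — `μ`-TRANSPORT of the analytic certificate `AnalyticMuLE · 2 0` along the isogeny class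
# (why the MAXIMAL-PERIOD member is the right selector; `--supports`, helper)

Cell `bsd-2adic`, lead `cruxlead-stmt-BirchSwinnertonDyer-19577` (g0).  THEOREMS ONLY — no definition, no named fact, no
`sorry`.  HONEST FRAMING: the crux 19577 is NOT closed here; BSD is not proved by any of this.

WHAT.  For ℚ-isogenous globally minimal `W ∼ W'`, good ordinary at `2`, with `Ω(W') = q·Ω(W)`:
* `analyticMuLE_two_zero_of_isIsogenous_of_padicValRat_nonneg` — if `v₂(q) ≥ 0` (the period of `W'` is 2-adically AT
  LEAST that of `W`) then `AnalyticMuLE W 2 0 → AnalyticMuLE W' 2 0`.  Reason: the two curves have the same newform `f`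
  (`IsNewformOf.of_isIsogenous`, same conductor `conductorNorm_eq_of_isIsogenous_of_hasGoodReductionAtPrime_two`) and the
  same unit root (`unitRoot_eq_of_isIsogenous`); the Néron ratios satisfy `ϖ = q·ϖ'` (`ϖ·Ω_W = Ω⁺_f = ϖ'·Ω_{W'}`), so every
  coefficient of `ϖ'·L₂(f,α)` is `q⁻¹` times the corresponding coefficient of `ϖ·L₂(f,α)`, and `‖q‖₂ ≤ 1`.
  So `μ(ϖ·L₂)` DECREASES (weakly) towards members of larger 2-adic period: the member of MAXIMAL 2-adic real period
  (registered stub `stub_maxPeriodWitness` of skeleton v4) MINIMISES `μ_an^{Nér}` over the class, and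
* `analyticMuLE_two_zero_atMaxPeriod_of_member` — `AnalyticMuLE · 2 0` at ANY globally minimal member transports to every
  maximal-period member `W″` (the selector of stub 4 `stub_analyticMuLEAtMaxPeriod`): the `∃`-form «some member has
  `μ_an ≤ 0`» and the NAMED form «the max-period member has `μ_an ≤ 0`» are equivalent.

References: R. Greenberg, LNM 1716 (1999), §5 p. 121 («`μ_E` changes as the period»); R. Greenberg, V. Vatsal,
Invent. Math. 142 (2000), §3 Remark 3.4.
-/

set_option autoImplicit false
-- the sub-problem namespace repeats the summit name by design (D-0017 nested layout)
set_option linter.dupNamespace false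

noncomputable section

open scoped Classical MatrixGroups ModularForm

open CongruenceSubgroup WeierstrassCurve Literature.NumberTheory.EllipticCurves
  Literature.NumberTheory.EllipticCurves.ModularForms Literature.NumberTheory.EllipticCurves.Rank1Residual
  Summit.BirchSwinnertonDyer.Rank1Residual.X1.MuPart
  Summit.BirchSwinnertonDyer.BirchSwinnertonDyer.Theorems.IsogenyMuShift

namespace Summit.BirchSwinnertonDyer.BirchSwinnertonDyer.Theorems.KatoFreeSandwich

section Transport

variable {W W' : WeierstrassCurve ℚ} [W.IsElliptic] [W.IsGloballyMinimal] [W'.IsElliptic] [W'.IsGloballyMinimal]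

/-- `‖q‖₂ ≤ 1` for a rational `q` with `v₂(q) ≥ 0` (and for `q = 0`). [folklore] -/
theorem padicNorm_ratCast_le_one_of_padicValRat_nonneg {p : ℕ} [Fact p.Prime] {q : ℚ}
    (hv : 0 ≤ padicValRat p q) : ‖(q : ℚ_[p])‖ ≤ 1 := by
  by_cases hq : q = 0
  · simp [hq]
  rw [Padic.eq_padicNorm, padicNorm.eq_zpow_of_nonzero hq]
  have hp : (1 : ℚ) ≤ p := by exact_mod_cast (Fact.out : p.Prime).one_lt.le
  exact_mod_cast zpow_le_one_of_nonpos₀ hp (neg_nonpos.mpr hv)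

/-- **`μ`-transport of the analytic certificate towards larger 2-adic period.**  `W ∼ W'` globally minimal, good ordinary
at `2`, `Ω(W') = q·Ω(W)` with `v₂(q) ≥ 0`: `AnalyticMuLE W 2 0 → AnalyticMuLE W' 2 0` (same newform and unit root;
`ϖ = q·ϖ'`; `‖q‖₂ ≤ 1`). [cite: GreenbergLNM1716, §5 p. 121 (μ and the period along an isogeny; shape)] -/
theorem analyticMuLE_two_zero_of_isIsogenous_of_padicValRat_nonneg (hgo : GoodOrd W 2) (hiso : IsIsogenous W W')
    {q : ℚ} (hq : W'.realPeriodRat = (q : ℝ) * W.realPeriodRat) (hv : 0 ≤ padicValRat 2 q)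
    (hA : AnalyticMuLE W 2 0) : AnalyticMuLE W' 2 0 := by
  intro _ f hf ϖ hϖ
  haveI : Fact (Nat.Prime 2) := ⟨Nat.prime_two⟩
  have hN : W.conductorNorm ℤ = W'.conductorNorm ℤ :=
    conductorNorm_eq_of_isIsogenous_of_hasGoodReductionAtPrime_two hiso hgo.1
  -- the hypothesis at `W`, with the level generalised so that `f` (at level `N_{W'} = N_W`) can be fed to it
  have key : ∀ (N : ℕ) [NeZero N] (g : CuspForm (Gamma0 N) 2), N = W.conductorNorm ℤ → IsNewformOf W g →
      ∀ ϖ₁ : ℚ, (ϖ₁ : ℝ) * W.realPeriodRat = plusPeriod g →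
      ∃ n : ℕ, (2 : ℝ) ^ (-((0 : ℕ) + 1 : ℤ)) <
        ‖PowerSeries.coeff n (PowerSeries.C (ϖ₁ : ℚ_[2]) * padicLFunction g (unitRoot W 2 : ℚ_[2]))‖ := by
    intro N _ g hN' hg ϖ₁ hϖ₁
    subst hN'
    exact hA g hg ϖ₁ hϖ₁
  have hfW : IsNewformOf W f := hf.of_isIsogenous hiso
  have hϖW : ((ϖ * q : ℚ) : ℝ) * W.realPeriodRat = plusPeriod f := by
    rw [← hϖ, hq]; push_cast; ring
  obtain ⟨n, hn⟩ := key (W'.conductorNorm ℤ) f hN.symm hfW (ϖ * q) hϖW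
  refine ⟨n, ?_⟩
  rw [unitRoot_eq_of_isIsogenous hiso hgo]
  rw [PowerSeries.coeff_C_mul] at hn ⊢
  have hsplit : ((ϖ * q : ℚ) : ℚ_[2]) * PowerSeries.coeff n (padicLFunction f (unitRoot W 2 : ℚ_[2])) =
      (q : ℚ_[2]) * ((ϖ : ℚ_[2]) * PowerSeries.coeff n (padicLFunction f (unitRoot W 2 : ℚ_[2]))) := by
    push_cast; ring
  rw [hsplit, norm_mul] at hn
  have hq1 : ‖(q : ℚ_[2])‖ ≤ 1 := padicNorm_ratCast_le_one_of_padicValRat_nonneg hv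
  exact lt_of_lt_of_le hn (mul_le_of_le_one_left (norm_nonneg _) hq1)

/-- **The maximal-period member carries the certificate of any member.**  If SOME globally minimal member `W` of the
class (good ordinary at `2`) has `AnalyticMuLE W 2 0`, then so does every globally minimal `W″ ∼ W` whose real period is
2-adically maximal in the class (the selector of the registered stubs of skeleton v4), PROVIDED the period ratio
`Ω(W″)/Ω(W)` is rational — which the caller supplies (it is, by Milne's archimedean isogeny formula; not re-proved here).
[cite: GreenbergLNM1716, §5 p. 121 (shape)] -/
theorem analyticMuLE_two_zero_atMaxPeriod_of_member (hgo : GoodOrd W 2) (hiso : IsIsogenous W W')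
    (hmax : ∀ (W₃ : WeierstrassCurve ℚ) [W₃.IsElliptic] [W₃.IsGloballyMinimal], IsIsogenous W' W₃ →
      ∀ q : ℚ, W₃.realPeriodRat = (q : ℝ) * W'.realPeriodRat → padicValRat 2 q ≤ 0)
    {q : ℚ} (hq : W'.realPeriodRat = (q : ℝ) * W.realPeriodRat) (hA : AnalyticMuLE W 2 0) :
    AnalyticMuLE W' 2 0 := by
  haveI : Fact (Nat.Prime 2) := ⟨Nat.prime_two⟩
  have hΩ : 0 < W.realPeriodRat := W.realPeriodRat_pos_holds
  have hΩ' : 0 < W'.realPeriodRat := W'.realPeriodRat_pos_holds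
  have hq0 : q ≠ 0 := by
    rintro rfl
    rw [Rat.cast_zero, zero_mul] at hq
    exact hΩ'.ne' hq
  -- `Ω(W) = q⁻¹·Ω(W')`, so maximality at `W'` gives `v₂(q⁻¹) ≤ 0`, i.e. `v₂(q) ≥ 0`
  have hq' : W.realPeriodRat = ((q⁻¹ : ℚ) : ℝ) * W'.realPeriodRat := by
    rw [hq, Rat.cast_inv, ← mul_assoc, inv_mul_cancel₀ (by exact_mod_cast hq0), one_mul]
  have hv' := hmax W (hiso.symm_of_charZero) q⁻¹ hq'
  rw [padicValRat.inv, neg_nonpos] at hv'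
  intro _ f hf ϖ hϖ
  exact analyticMuLE_two_zero_of_isIsogenous_of_padicValRat_nonneg hgo hiso hq hv' hA f hf ϖ hϖ

end Transport

end Summit.BirchSwinnertonDyer.BirchSwinnertonDyer.Theorems.KatoFreeSandwich

end
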